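import Summits.Ventures.AbcSig.Levels.N7264P1
import Summits.Ventures.AbcSig.Levels.N7264Q1
import Summits.Ventures.AbcSig.Levels.N7264S2
import Summits.Ventures.AbcSig.Levels.N7264S3
import Summits.Ventures.AbcSig.Levels.N7264S4

/-!
# Venture AbcSig — GENERATED level file, level 7264 (AGGREGATOR of 5 part files)

HONEST FRAMING. As in the part files `N7264P<i>.lean` (same generator run, same certified level file
`N7264.engine1.json`, sha256 `d359628c27f2aa1584e4599c1c2e40cd4dd3239ba47ce56e492fba4bd8d7d3e2`): this file only concatenates the orbit lists and the part summaries into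
`level7264Orbits`, `level7264_wellformed`, `level7264_sieve` (the shapes the row templates consume). The split exists because the
tree's files are ≤ 400 lines. Union of residual exponents ≥ 7: [7, 19]; orbits not eliminable by the sieve:
none. No Diophantine statement is made here; no claim on ABC or any summit.
-/

namespace Summit.Ventures.AbcSig

/-- All newform orbits of level 7264 (concatenation of the parts, engine order). -/
def level7264Orbits : List OrbitData :=
  level7264OrbitsP1 ++ level7264OrbitsQ1 ++ level7264OrbitsS2 ++ level7264OrbitsS3 ++ level7264OrbitsS4

/-- Every listed entry is at an odd prime not dividing 7264. -/
theorem level7264_wellformed :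
    ∀ o ∈ level7264Orbits, ∀ e ∈ o.coeffs, e.ell.Prime ∧ e.ell ≠ 2 ∧ ¬ e.ell ∣ 7264 := by
  unfold level7264Orbits
  exact List.forall_mem_append.2 ⟨List.forall_mem_append.2 ⟨List.forall_mem_append.2 ⟨List.forall_mem_append.2 ⟨level7264_wellformedP1, level7264_wellformedQ1⟩, level7264_wellformedS2⟩, level7264_wellformedS3⟩, level7264_wellformedS4⟩

/-- **Level 7264 summary.** For a prime exponent `n ≥ 7`, every orbit of level 7264 is sieve-eliminated by the
kernel certificates of the part files, except that the row's predicate `X` is assumed for: orbit_7264_7 if n ∈ [7, 19], orbit_7264_8 if n ∈ [7, 19], orbit_7264_9 if n ∈ [7], orbit_7264_10 if n ∈ [7]. -/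
theorem level7264_sieve (n : ℕ) (hn : n.Prime) (hmin : 7 ≤ n) (X : OrbitData → Prop)
    (h_orbit_7264_7 : n ∈ ([7, 19] : List ℕ) → X orbit_7264_7)
    (h_orbit_7264_8 : n ∈ ([7, 19] : List ℕ) → X orbit_7264_8)
    (h_orbit_7264_9 : n ∈ ([7] : List ℕ) → X orbit_7264_9)
    (h_orbit_7264_10 : n ∈ ([7] : List ℕ) → X orbit_7264_10) :
    ∀ o ∈ level7264Orbits, (∀ e ∈ o.coeffs, e.ell.Prime ∧ e.ell ≠ 2 ∧ ¬ e.ell ∣ 7264) ∧ (o.Eliminated bs04Allowed n ∨ X o) := by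
  unfold level7264Orbits
  exact List.forall_mem_append.2 ⟨List.forall_mem_append.2 ⟨List.forall_mem_append.2 ⟨List.forall_mem_append.2 ⟨(level7264_sieveP1 n hn hmin X), (level7264_sieveQ1 n hn hmin X)⟩, (level7264_sieveS2 n hn hmin X h_orbit_7264_7 h_orbit_7264_8)⟩, (level7264_sieveS3 n hn hmin X h_orbit_7264_9)⟩, (level7264_sieveS4 n hn hmin X h_orbit_7264_10)⟩

end Summit.Ventures.AbcSig
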